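import Summits.BirchSwinnertonDyer.BirchSwinnertonDyer.Theorems.ResidualThetaTransportAtTwoThetaLayerLambdaCongruenceAtTwoStarDepletedForm
import Literature.NumberTheory.EllipticCurves.ModularSymbolsPeriodHomology
import Literature.NumberTheory.EllipticCurves.EichlerShimuraMapDegree
import Literature.NumberTheory.EllipticCurves.PeriodLatticeRationalityUnconditionalProofs
import Literature.NumberTheory.EllipticCurves.EichlerShimuraConstructionProofs
import Literature.NumberTheory.EllipticCurves.AnalyticIsogenyDescentProofs
import Literature.NumberTheory.EllipticCurves.ModularCurveNeronLatticeProofs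
import Literature.NumberTheory.EllipticCurves.GlobalMinimalModelProofs
import Literature.NumberTheory.EllipticCurves.IsogenyDualProofs
import Literature.NumberTheory.EllipticCurves.ModularParametrizationDegree
import HarnessLib

/-!
# Crux `MazurTateCongruenceAtTwoTop` (stmt-BirchSwinnertonDyer-25797 = `MazurTateCongruenceAtTwoR` 21416), line `symbol`:
# THE EICHLER–SHIMURA DEPLETED-LATTICE INPUT `hES` OF THE K1 CHAIN, DERIVED — `(∏_{ℓ∈S} ℓ²)·Λ_g ⊆ Λ_f` and the curve `ℂ/Λ_g`
# over `ℚ`, isogenous to `W`, from `IsNewformOf.exists_maninConstant_ne_zero` alone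
# (width seat bsd-wall-tp2-p1-w2 g5; `--supports stmt-BirchSwinnertonDyer-25797`; THEOREMS ONLY — no `def`, no named fact)

HONEST FRAMING. Nothing here proves BSD or closes an item. The last theorem is CONDITIONAL on one displayed named fact,
`IsNewformOf.exists_maninConstant_ne_zero` (`ModularParametrizationDegree.lean`: for the newform `f` of an elliptic curve
`W/ℚ` and a Néron lattice `Λ_W`, some nonzero integer `c₀` has `c₀Λ_f ⊆ Λ_W` — Breuil–Conrad–Diamond–Taylor 2001 (2)⇒(6) with
Knapp Thm. 11.74 / Faltings; in the tree its trust base is the Eichler–Shimura congruence relation,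
`PeriodLatticeRationalityUnconditionalProofs.exists_maninConstant_ne_zero_of_congruenceRelation_cofinite`). Everything else
is a theorem of the tree.

WHY. In the landed K1 chain (`plusLineCharTwo_of_threeFacts` ← `kTwo_of_dvd_of_esSdBz` ← `kTwo_of_dvd_noMazur`, files
`…MazurTateCongruenceAtTwoRPlusLineThreeFacts`, `…ThetaLayerLambdaCongruenceAtTwoNoMazurKenku`) the named fact
`eichlerShimura_depletedOptimalQuotient_periodLattice_of_dvd` (an ASSEMBLED statement about the optimal quotient of `J₀(L)` attached
to the `S`-depleted form `g`, with no single printed source) is used at exactly one place, and only through: an elliptic curve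
`A/ℚ` (globally minimal) with Néron lattice `Λ_A = c·Λ_g`, `c ∈ ℚ^×`, that is `ℚ`-isogenous to the given curve `W` (the isogeny
being obtained there from the fact's `a_p` clause by Faltings). THIS FILE PROVES exactly that W-relative statement
(`exists_depletedLatticeCurve_isIsogenous`) from `IsNewformOf.exists_maninConstant_ne_zero` and tree theorems, so that the
K1 chain can be re-threaded with the mainstream parametrisation fact in place of the assembled one (companion file
`…RPlusLineOfManinConstant`).

HOW (all steps are tree theorems).
* §1 `modularSymbol_iota`, `exists_cuspSymbol_iota`: `{∞, r}_{ι_d h} = d⁻¹{∞, dr}_h` (Cremona 1997 §2.4, the substitution of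
  `modularSymbol_slash_tpD`) and `{∞, γ∞}_{ι_d h} = d⁻¹{∞, δ∞}_h` with `δ ∈ Γ₀(M)` written down from the first column of `γ`
  (`Gamma0.mkOfCol`).
* §2 `mul_cuspSymbol_depleted_mem_of_eq`: `(∏_{ℓ∈S} ℓ²)·{∞, γ∞}_g ∈ Λ_f` by induction over the sieve
  `g = K_ℓ g₀ = g₀ − ι_ℓ(T_ℓ g₀ − 𝟙_{ℓ∤L₀}ℓ ι_ℓ g₀)` (`sieveOp`, `uOp`, Atkin–Lehner 1970 §3), `T_ℓ g₀ = a_ℓ(f) g₀`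
  (`depleted_heckeT_eq_smul`), `a_ℓ(f) ∈ ℤ`.
* §3 `mul_mem_periodLattice_of_mem_periodLattice_depleted` (any level `L` with `N∏ℓ² ∣ L`) and
  `exists_depletedLatticeCurve_isIsogenous`: `c₀(∏ℓ²)Λ_g ⊆ Λ_W` makes `Λ_g` discrete (`discreteTopology_periodLattice_of_mul_mem`)
  hence a period-pair lattice (`exists_periodPair_lattice_eq_periodLattice`); `g₂(Λ_g), g₃(Λ_g) ∈ ℚ` by Shimura's `Aut(ℂ)`-descent
  (`PeriodPair.ratCast_g₂_g₃_of_lattice_eq_periodLattice`, which needs only `g ≠ 0` with rational coefficients); the short model of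
  `ℂ/Λ_g` (`isElliptic_shortModel`, `isNeronLatticeOf_shortModel`), a global minimal model (`hasGlobalMinimalModel_rat_holds`,
  `IsNeronLatticeOf.smul`), and `A ~_ℚ W` by analytic isogeny descent (`isIsogenous_of_forall_mul_mem_lattice`) from
  `(c₀∏ℓ²/u)·Λ_A ⊆ Λ_W`.

References: A. O. L. Atkin, J. Lehner, Math. Ann. 185 (1970) §3 [AtkinLehner1970]; J. E. Cremona, *Algorithms for modular
elliptic curves* (1997) §2.4, §2.14 [CremonaAlgorithms1997]; A. W. Knapp, *Elliptic Curves* (1993) Thm. 11.74 (d) [Knapp1993];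
A. Agashe, K. Ribet, W. Stein, PAMQ 2 (2006) §3 [AgasheRibetStein2006]; C. Breuil, B. Conrad, F. Diamond, R. Taylor, JAMS 14
(2001) p. 845 [BCDTJAMS2001].
-/

noncomputable section

-- justification: the `Summit.BirchSwinnertonDyer.BirchSwinnertonDyer.…` path repeats a component (route-file convention)
set_option linter.dupNamespace false
set_option autoImplicit false

open scoped MatrixGroups ModularForm

open CongruenceSubgroup Complex MeasureTheory Set
open Literature.NumberTheory.EllipticCurves Literature.NumberTheory.EllipticCurves.ModularForms

namespace Summit.BirchSwinnertonDyer.BirchSwinnertonDyer.Theorems.MazurTateCongruenceAtTwoR.DepletedLattice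

/-! ## §1. Periods of `ι_d h` and of level-raised forms -/

/-- An element of `Γ₀(N')` lies in `Γ₀(M)` when `M ∣ N'`. [folklore] -/
theorem mem_gamma0_of_dvd {M N' : ℕ} (h : M ∣ N') (γ : Gamma0 N') : (γ : SL(2, ℤ)) ∈ Gamma0 M := by
  have hγ := γ.2
  rw [Gamma0_mem, ZMod.intCast_zmod_eq_zero_iff_dvd] at hγ ⊢
  exact (Int.natCast_dvd_natCast.mpr h).trans hγ

/-- `{∞, γ∞}` of a level-raised form is the same period at the lower level. [folklore] -/
theorem cuspSymbol_toLevel0 {M N' : ℕ} (h : M ∣ N') (g : CuspForm (Gamma0 M) 2) (γ : Gamma0 N') :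
    cuspSymbol (toLevel0 h 2 g) γ = cuspSymbol g ⟨(γ : SL(2, ℤ)), mem_gamma0_of_dvd h γ⟩ := by
  rfl

/-- `{∞, r}_{ι_d h} = d⁻¹ · {∞, d r}_h`: the substitution `s = dt` in `(ι_d h)(z) = h(dz)`
(Cremona 1997, §2.4). [cite: CremonaAlgorithms1997, §2.4] -/
theorem modularSymbol_iota {M N' d : ℕ} [NeZero d] (h : M * d ∣ N') (g : CuspForm (Gamma0 M) 2) (r : ℚ) :
    modularSymbol (iota M N' d 2 h g) r = (d : ℂ)⁻¹ * modularSymbol g (d * r) := by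
  rw [modularSymbol, ← modularSymbol_slash_tpD d g r]
  have hcoe : ∀ t : ℝ, (iota M N' d 2 h g) (UpperHalfPlane.ofComplex ((r : ℂ) + t * I)) =
      (d : ℂ)⁻¹ * (⇑g ∣[(2 : ℤ)] tpD d) (UpperHalfPlane.ofComplex ((r : ℂ) + t * I)) := fun t ↦ by
    have := congrFun (coe_iota M N' d 2 h g) (UpperHalfPlane.ofComplex ((r : ℂ) + t * I))
    rw [this, Pi.smul_apply, smul_eq_mul]
    norm_num
  simp_rw [hcoe]
  rw [integral_const_mul]
  ring

/-- **`{∞, γ∞}_{ι_d h} = d⁻¹ {∞, δ∞}_h` for some `δ ∈ Γ₀(M)`** (`γ ∈ Γ₀(N')`, `M d ∣ N'`): with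
`γ∞ = a/c`, `c = d c'`, one has `d · (a/c) = a/c'` and `δ = (a *; c' *) ∈ Γ₀(M)`. [folklore] -/
theorem exists_cuspSymbol_iota {M N' d : ℕ} [NeZero d] (h : M * d ∣ N') (g : CuspForm (Gamma0 M) 2)
    (γ : Gamma0 N') :
    ∃ δ : Gamma0 M, cuspSymbol (iota M N' d 2 h g) γ = (d : ℂ)⁻¹ * cuspSymbol g δ := by
  by_cases hc : (γ : SL(2, ℤ)) 1 0 = 0
  · refine ⟨1, ?_⟩
    rw [cuspSymbol, if_pos hc, cuspSymbol_one, mul_zero]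
  · set a : ℤ := (γ : SL(2, ℤ)) 0 0 with ha
    set c : ℤ := (γ : SL(2, ℤ)) 1 0 with hc'
    -- `N' ∣ c`, hence `d ∣ c` and `M ∣ c / d`
    have hN'c : (N' : ℤ) ∣ c := by
      have hγ := γ.2
      rw [Gamma0_mem, ZMod.intCast_zmod_eq_zero_iff_dvd] at hγ
      exact hγ
    have hdc : (d : ℤ) ∣ c :=
      ((Int.natCast_dvd_natCast.mpr (Dvd.intro_left _ rfl : d ∣ M * d)).trans
        (Int.natCast_dvd_natCast.mpr h)).trans hN'c
    obtain ⟨c', hcc'⟩ := hdc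
    have hd0 : (d : ℤ) ≠ 0 := by exact_mod_cast NeZero.ne d
    have hc'0 : c' ≠ 0 := by
      rintro rfl
      exact hc (by rw [hcc', mul_zero])
    have hMc' : (M : ℤ) ∣ c' := by
      have h1 : ((M * d : ℕ) : ℤ) ∣ c := (Int.natCast_dvd_natCast.mpr h).trans hN'c
      rw [hcc', Nat.cast_mul, mul_comm (M : ℤ)] at h1
      exact Int.dvd_of_mul_dvd_mul_left hd0 h1
    have hcop : IsCoprime a c' := by
      have hdet := Matrix.SpecialLinearGroup.det_coe (γ : SL(2, ℤ))
      rw [Matrix.det_fin_two] at hdet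
      have : IsCoprime a c := by
        refine ⟨(γ : SL(2, ℤ)) 1 1, -(γ : SL(2, ℤ)) 0 1, ?_⟩
        rw [ha, hc']
        linear_combination hdet
      rw [hcc'] at this
      exact this.of_mul_right_right
    refine ⟨Gamma0.mkOfCol a c' hcop hMc', ?_⟩
    rw [cuspSymbol, if_neg hc, modularSymbol_iota, cuspSymbol,
      if_neg (by rw [Gamma0.mkOfCol_apply_one_zero]; exact hc'0), Gamma0.mkOfCol_apply_zero_zero,
      Gamma0.mkOfCol_apply_one_zero]
    congr 2
    rw [← ha, ← hc', hcc']
    push_cast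
    have hc'Q : (c' : ℚ) ≠ 0 := by exact_mod_cast hc'0
    have hdQ : (d : ℚ) ≠ 0 := by exact_mod_cast NeZero.ne d
    field_simp


/-! ## §2. The periods of the `S`-depleted form lie in `(∏_{ℓ∈S} ℓ²)⁻¹ Λ_f` -/

open Summit.BirchSwinnertonDyer.BirchSwinnertonDyer.Theorems.ThetaLayerLambdaCongruenceAtTwo in
/-- **`(∏_{ℓ∈S} ℓ²)·{∞, γ∞}_g ∈ Λ_f` at the depleted level `L = N·∏_{ℓ∈S} ℓ²`.** For `f ∈ S₂(Γ₀(N))` with integer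
coefficients and `T_p f = a_p(f) f` for all primes `p`, a finite set `S` of primes, and `g ∈ S₂(Γ₀(L))` the `S`-depleted form
(`a_n(g) = 𝟙_{(n,S)=1} a_n(f)`): every period `{∞, γ∞}_g`, `γ ∈ Γ₀(L)`, multiplied by `∏_{ℓ∈S} ℓ²`, is a period of `f`.
Induction over the sieve `g = K_ℓ g₀ = g₀ − a_ℓ ι_ℓ g₀ + 𝟙_{ℓ∤L₀} ℓ ι_ℓ ι_ℓ g₀` (Atkin–Lehner `f − f∣U_ℓ∣B_ℓ`) and
`{∞, γ∞}_{ι_ℓ h} = ℓ⁻¹ {∞, δ∞}_h` (`exists_cuspSymbol_iota`). [cite: AtkinLehner1970, §3] [cite: CremonaAlgorithms1997, §2.4] -/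
theorem mul_cuspSymbol_depleted_mem_of_eq {N : ℕ} [NeZero N] (f : CuspForm (Gamma0 N) 2)
    (hint : ∀ n : ℕ, ∃ z : ℤ, cuspCoeff f n = z)
    (hT : ∀ (p : ℕ) (hp : p.Prime), (haveI : NeZero p := ⟨hp.ne_zero⟩; heckeT (Gamma0 N) 2 p f) = cuspCoeff f p • f)
    (S : Finset ℕ) (hS : ∀ ℓ ∈ S, ℓ.Prime) (L : ℕ) [NeZero L] (hL : L = N * ∏ ℓ ∈ S, ℓ ^ 2)
    (g : CuspForm (Gamma0 L) 2) (hg : ∀ n : ℕ, cuspCoeff g n = if ∃ ℓ ∈ S, ℓ ∣ n then 0 else cuspCoeff f n)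
    (γ : Gamma0 L) : ((∏ ℓ ∈ S, ℓ ^ 2 : ℕ) : ℂ) * cuspSymbol g γ ∈ periodLattice f := by
  classical
  induction S using Finset.induction_on generalizing L g with
  | empty =>
    have hNL : N ∣ L := by rw [hL]; exact dvd_mul_right N _
    have hgf : g = toLevel0 hNL 2 f := by
      refine eq_of_forall_cuspCoeff_eq_gamma0 fun n ↦ ?_
      rw [hg n, if_neg (by simp)]
      rfl
    rw [Finset.prod_empty, Nat.cast_one, one_mul, hgf, cuspSymbol_toLevel0]
    exact cuspSymbol_mem_periodLattice f _
  | insert ℓ S hℓS ih =>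
    have hSp : ∀ ℓ' ∈ S, ℓ'.Prime := fun ℓ' h ↦ hS ℓ' (Finset.mem_insert_of_mem h)
    have hℓ : ℓ.Prime := hS ℓ (Finset.mem_insert_self ℓ S)
    set L₀ : ℕ := N * ∏ ℓ' ∈ S, ℓ' ^ 2 with hL₀
    haveI : NeZero L₀ := ⟨mul_ne_zero (NeZero.ne N) (prod_sq_ne_zero_of_prime S hSp)⟩
    haveI : NeZero ℓ := ⟨hℓ.ne_zero⟩
    obtain ⟨g₀, hg₀⟩ := exists_cuspForm_coeff_eq_depleted f S hSp L₀ rfl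
    have hL' : L = L₀ * ℓ * ℓ := by
      rw [hL, Finset.prod_insert hℓS, hL₀]; ring
    subst hL'
    -- `g` is the sieve of `g₀`
    have hgs : g = sieveOp L₀ 2 ℓ g₀ := by
      refine eq_of_forall_cuspCoeff_eq_gamma0 fun n ↦ ?_
      rw [hg n]
      change _ = (UpperHalfPlane.qExpansion 1 ⇑(sieveOp L₀ 2 ℓ g₀)).coeff n
      rw [qExpansion_coeff_sieveOp hℓ g₀ n]
      change _ = (if ℓ ∣ n then 0 else cuspCoeff g₀ n)
      rw [hg₀ n]
      by_cases hℓn : ℓ ∣ n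
      · rw [if_pos hℓn, if_pos ⟨ℓ, Finset.mem_insert_self ℓ S, hℓn⟩]
      · rw [if_neg hℓn]
        by_cases hex : ∃ ℓ' ∈ S, ℓ' ∣ n
        · obtain ⟨ℓ', hℓ', hd⟩ := hex
          rw [if_pos ⟨ℓ', Finset.mem_insert_of_mem hℓ', hd⟩, if_pos ⟨ℓ', hℓ', hd⟩]
        · rw [if_neg hex, if_neg]
          rintro ⟨ℓ', hℓ', hd⟩
          rcases Finset.mem_insert.mp hℓ' with rfl | h
          · exact hℓn hd
          · exact hex ⟨ℓ', h, hd⟩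
    -- the eigenvalue `a_ℓ ∈ ℤ` of `g₀`
    obtain ⟨a, ha⟩ := hint ℓ
    have hTg₀ : heckeT (Gamma0 L₀) 2 ℓ g₀ = (a : ℂ) • g₀ := by
      rw [← ha]
      exact depleted_heckeT_eq_smul hSp hg₀ hℓ hℓS (dvd_level_iff hSp rfl hℓ hℓS) (hT ℓ hℓ)
    -- the three periods of `g₀` entering `{∞, γ∞}_g`
    obtain ⟨δ, hδ⟩ := exists_cuspSymbol_iota (dvd_rfl : L₀ * ℓ * ℓ ∣ L₀ * ℓ * ℓ) (uOp L₀ 2 ℓ g₀) γ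
    obtain ⟨δ', hδ'⟩ := exists_cuspSymbol_iota (dvd_rfl : L₀ * ℓ ∣ L₀ * ℓ) g₀ δ
    set γ₀ : Gamma0 L₀ := ⟨(γ : SL(2, ℤ)), mem_gamma0_of_dvd (⟨ℓ * ℓ, by ring⟩ : L₀ ∣ L₀ * ℓ * ℓ) γ⟩ with hγ₀
    set δ₀ : Gamma0 L₀ := ⟨(δ : SL(2, ℤ)), mem_gamma0_of_dvd (dvd_mul_right L₀ ℓ) δ⟩ with hδ₀
    have hx₀ := ih hSp L₀ rfl g₀ hg₀ γ₀
    have hx₁ := ih hSp L₀ rfl g₀ hg₀ δ₀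
    have hx₂ := ih hSp L₀ rfl g₀ hg₀ δ'
    set D : ℕ := ∏ ℓ' ∈ S, ℓ' ^ 2 with hD
    -- `{∞, γ∞}_g` in terms of the periods of `g₀`
    have huOp : cuspSymbol (uOp L₀ 2 ℓ g₀) δ =
        (a : ℂ) * cuspSymbol g₀ δ₀ - (if ℓ ∣ L₀ then (0 : ℂ) else (ℓ : ℂ)) * ((ℓ : ℂ)⁻¹ * cuspSymbol g₀ δ') := by
      rw [← periodFunctional_apply, uOp, LinearMap.sub_apply, LinearMap.comp_apply, LinearMap.smul_apply, map_sub,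
        map_smul, periodFunctional_apply, periodFunctional_apply, cuspSymbol_toLevel0, hTg₀, cuspSymbol_smul, hδ',
        smul_eq_mul]
      congr 2
      split_ifs <;> simp
    have hper : cuspSymbol g γ = cuspSymbol g₀ γ₀ - (ℓ : ℂ)⁻¹ * cuspSymbol (uOp L₀ 2 ℓ g₀) δ := by
      rw [hgs, ← periodFunctional_apply, sieveOp, LinearMap.sub_apply, LinearMap.comp_apply, map_sub,
        periodFunctional_apply, periodFunctional_apply, cuspSymbol_toLevel0, hδ]
    have hℓ0 : (ℓ : ℂ) ≠ 0 := by exact_mod_cast hℓ.ne_zero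
    rw [Finset.prod_insert hℓS, hper, huOp]
    by_cases hℓL₀ : ℓ ∣ L₀
    · rw [if_pos hℓL₀]
      have key : ((ℓ ^ 2 * D : ℕ) : ℂ) * (cuspSymbol g₀ γ₀ - (ℓ : ℂ)⁻¹ * ((a : ℂ) * cuspSymbol g₀ δ₀ -
          0 * ((ℓ : ℂ)⁻¹ * cuspSymbol g₀ δ'))) =
          ((ℓ : ℤ) ^ 2) • ((D : ℂ) * cuspSymbol g₀ γ₀) - ((ℓ : ℤ) * a) • ((D : ℂ) * cuspSymbol g₀ δ₀) := by
        simp only [zsmul_eq_mul]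
        push_cast
        field_simp
        ring
      rw [key]
      exact sub_mem (AddSubgroup.zsmul_mem _ hx₀ _) (AddSubgroup.zsmul_mem _ hx₁ _)
    · rw [if_neg hℓL₀]
      have key : ((ℓ ^ 2 * D : ℕ) : ℂ) * (cuspSymbol g₀ γ₀ - (ℓ : ℂ)⁻¹ * ((a : ℂ) * cuspSymbol g₀ δ₀ -
          (ℓ : ℂ) * ((ℓ : ℂ)⁻¹ * cuspSymbol g₀ δ'))) =
          ((ℓ : ℤ) ^ 2) • ((D : ℂ) * cuspSymbol g₀ γ₀) - ((ℓ : ℤ) * a) • ((D : ℂ) * cuspSymbol g₀ δ₀) +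
            (ℓ : ℤ) • ((D : ℂ) * cuspSymbol g₀ δ') := by
        simp only [zsmul_eq_mul]
        push_cast
        field_simp
        ring
      rw [key]
      exact add_mem (sub_mem (AddSubgroup.zsmul_mem _ hx₀ _) (AddSubgroup.zsmul_mem _ hx₁ _))
        (AddSubgroup.zsmul_mem _ hx₂ _)

/-! ## §3. Flexible level, the lattice `Λ_g`, and the curve `ℂ/Λ_g` over `ℚ` -/

open Summit.BirchSwinnertonDyer.BirchSwinnertonDyer.Theorems.ThetaLayerLambdaCongruenceAtTwo in
/-- **`(∏_{ℓ∈S} ℓ²)·{∞, γ∞}_g ∈ Λ_f` at ANY level `L` with `N·∏_{ℓ∈S} ℓ² ∣ L`** (the `S`-depleted form at level `L` is the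
level-raised depleted form of level `N·∏ℓ²`, same function on `ℍ`). [cite: AtkinLehner1970, §3] -/
theorem mul_cuspSymbol_depleted_mem {N : ℕ} [NeZero N] (f : CuspForm (Gamma0 N) 2)
    (hint : ∀ n : ℕ, ∃ z : ℤ, cuspCoeff f n = z)
    (hT : ∀ (p : ℕ) (hp : p.Prime), (haveI : NeZero p := ⟨hp.ne_zero⟩; heckeT (Gamma0 N) 2 p f) = cuspCoeff f p • f)
    (S : Finset ℕ) (hS : ∀ ℓ ∈ S, ℓ.Prime) (L : ℕ) [NeZero L] (hNL : N * ∏ ℓ ∈ S, ℓ ^ 2 ∣ L)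
    (g : CuspForm (Gamma0 L) 2) (hg : ∀ n : ℕ, cuspCoeff g n = if ∃ ℓ ∈ S, ℓ ∣ n then 0 else cuspCoeff f n)
    (γ : Gamma0 L) : ((∏ ℓ ∈ S, ℓ ^ 2 : ℕ) : ℂ) * cuspSymbol g γ ∈ periodLattice f := by
  classical
  set L₀ : ℕ := N * ∏ ℓ ∈ S, ℓ ^ 2 with hL₀
  haveI : NeZero L₀ := ⟨mul_ne_zero (NeZero.ne N) (prod_sq_ne_zero_of_prime S hS)⟩
  obtain ⟨g₀, hg₀⟩ := exists_cuspForm_coeff_eq_depleted f S hS L₀ rfl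
  have hgs : g = toLevel0 hNL 2 g₀ := by
    refine eq_of_forall_cuspCoeff_eq_gamma0 fun n ↦ ?_
    rw [hg n]
    exact (hg₀ n).symm
  rw [hgs, cuspSymbol_toLevel0]
  exact mul_cuspSymbol_depleted_mem_of_eq f hint hT S hS L₀ rfl g₀ hg₀ _

open Summit.BirchSwinnertonDyer.BirchSwinnertonDyer.Theorems.ThetaLayerLambdaCongruenceAtTwo in
/-- **`(∏_{ℓ∈S} ℓ²) · Λ_g ⊆ Λ_f`**: the period group of the `S`-depleted form `g` (level `L`, `N·∏_{ℓ∈S} ℓ² ∣ L`) of a Hecke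
eigenform `f ∈ S₂(Γ₀(N))` with integer coefficients lies in `(∏ ℓ²)⁻¹ Λ_f`. [cite: AtkinLehner1970, §3]
[cite: CremonaAlgorithms1997, §2.4] -/
theorem mul_mem_periodLattice_of_mem_periodLattice_depleted {N : ℕ} [NeZero N] (f : CuspForm (Gamma0 N) 2)
    (hint : ∀ n : ℕ, ∃ z : ℤ, cuspCoeff f n = z)
    (hT : ∀ (p : ℕ) (hp : p.Prime), (haveI : NeZero p := ⟨hp.ne_zero⟩; heckeT (Gamma0 N) 2 p f) = cuspCoeff f p • f)
    (S : Finset ℕ) (hS : ∀ ℓ ∈ S, ℓ.Prime) (L : ℕ) [NeZero L] (hNL : N * ∏ ℓ ∈ S, ℓ ^ 2 ∣ L)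
    (g : CuspForm (Gamma0 L) 2) (hg : ∀ n : ℕ, cuspCoeff g n = if ∃ ℓ ∈ S, ℓ ∣ n then 0 else cuspCoeff f n) :
    ∀ z ∈ periodLattice g, ((∏ ℓ ∈ S, ℓ ^ 2 : ℕ) : ℂ) * z ∈ periodLattice f := by
  have hle : periodLattice g ≤ (periodLattice f).comap (AddMonoidHom.mulLeft ((∏ ℓ ∈ S, ℓ ^ 2 : ℕ) : ℂ)) := by
    rw [periodLattice, AddSubgroup.closure_le]
    rintro _ ⟨γ, rfl⟩
    exact mul_cuspSymbol_depleted_mem f hint hT S hS L hNL g hg γ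
  exact fun z hz ↦ hle hz

open Summit.BirchSwinnertonDyer.BirchSwinnertonDyer.Theorems.ThetaLayerLambdaCongruenceAtTwo in
/-- **The Eichler–Shimura depleted-lattice input of the K1 / Kan⁺ chains, RELATIVE TO A PARAMETRISED CURVE, from the fact
`IsNewformOf.exists_maninConstant_ne_zero` alone.** Let `W/ℚ` be an elliptic curve with newform `f ∈ S₂(Γ₀(N))`
(`IsNewformOf W f`), `S` a finite set of primes, `L` a level with `N·∏_{ℓ∈S} ℓ² ∣ L`, and `g ∈ S₂(Γ₀(L))` the `S`-depleted
form. Then there are a globally minimal elliptic curve `A/ℚ`, a Néron-type period pair `L_A` of `A` and `c ∈ ℚ^×` with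
`Λ_A = c·Λ_g` (`Λ_g = periodLattice g`), and `A` is `ℚ`-isogenous to `W`. Construction: `(∏ℓ²)Λ_g ⊆ Λ_f`
(`mul_mem_periodLattice_of_mem_periodLattice_depleted`) and `c₀Λ_f ⊆ Λ_W` (the named fact) make `Λ_g` discrete, hence a
lattice spanned by a period pair (`exists_periodPair_lattice_eq_periodLattice`); `g₂(Λ_g), g₃(Λ_g) ∈ ℚ`
(`PeriodPair.ratCast_g₂_g₃_of_lattice_eq_periodLattice`, Shimura's construction by `Aut(ℂ)`-descent), so `ℂ/Λ_g` is a short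
Weierstrass curve over `ℚ` with Néron-type lattice `Λ_g`; pass to a global minimal model (`hasGlobalMinimalModel_rat_holds`,
`IsNeronLatticeOf.smul`); the inclusion `(c₀∏ℓ²/c)·Λ_A ⊆ Λ_W` makes `A ~_ℚ W` (`isIsogenous_of_forall_mul_mem_lattice`,
analytic isogeny descent). This replaces, inside the K1 chain, the assembled named fact
`eichlerShimura_depletedOptimalQuotient_periodLattice_of_dvd`. [cite: Knapp1993, Thm. 11.74 (d)]
[cite: CremonaAlgorithms1997, §2.14] [cite: AgasheRibetStein2006, §3 (pp. 620–621)] -/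
theorem exists_depletedLatticeCurve_isIsogenous (hMC : IsNewformOf.exists_maninConstant_ne_zero)
    (W : WeierstrassCurve ℚ) [W.IsElliptic] {N : ℕ} [NeZero N] {f : CuspForm (Gamma0 N) 2} (hf : IsNewformOf W f)
    (S : Finset ℕ) (hS : ∀ ℓ ∈ S, ℓ.Prime) (L : ℕ) [NeZero L] (hNL : N * ∏ ℓ ∈ S, ℓ ^ 2 ∣ L)
    (g : CuspForm (Gamma0 L) 2) (hg : ∀ n : ℕ, cuspCoeff g n = if ∃ ℓ ∈ S, ℓ ∣ n then 0 else cuspCoeff f n) :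
    ∃ (A : WeierstrassCurve ℚ) (_ : A.IsElliptic) (_ : A.IsGloballyMinimal) (LA : PeriodPair) (c : ℚ),
      IsNeronLatticeOf (A.baseChange ℂ) LA ∧ c ≠ 0 ∧
      (∀ z : ℂ, z ∈ LA.lattice ↔ ∃ w ∈ periodLattice g, z = (c : ℂ) * w) ∧ WeierstrassCurve.IsIsogenous W A := by
  classical
  set D : ℕ := ∏ ℓ ∈ S, ℓ ^ 2 with hDdef
  have hD0 : (D : ℂ) ≠ 0 := by
    rw [hDdef]; exact_mod_cast prod_sq_ne_zero_of_prime S hS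
  -- `f`: integer coefficients, Hecke eigenform
  have hint : ∀ n : ℕ, ∃ z : ℤ, cuspCoeff f n = z := fun n ↦ ⟨W.LFunction n, hf.2 n⟩
  have hTf : ∀ (p : ℕ) (hp : p.Prime), (haveI : NeZero p := ⟨hp.ne_zero⟩; heckeT (Gamma0 N) 2 p f) = cuspCoeff f p • f :=
    fun p hp ↦ by haveI : NeZero p := ⟨hp.ne_zero⟩; exact hf.1.heckeT_eq_coeff_smul hp
  have hDΛ := mul_mem_periodLattice_of_mem_periodLattice_depleted f hint hTf S hS L hNL g hg
  -- a Néron lattice of `W` and the Manin-constant inclusion `c₀ Λ_f ⊆ Λ_W`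
  haveI : (W.baseChange ℂ).IsElliptic := by rw [WeierstrassCurve.baseChange]; infer_instance
  obtain ⟨LW, hLW⟩ := exists_isNeronLatticeOf_holds (W.baseChange ℂ)
  obtain ⟨c₀, hc₀, hc₀Λ⟩ := hMC hf hLW
  -- `Λ_g` is discrete, hence spanned by a period pair
  have hg1 : cuspCoeff g 1 = 1 := by
    rw [hg 1, if_neg]
    · exact hf.1.2.2
    · rintro ⟨ℓ, hℓ, hd⟩
      exact (hS ℓ hℓ).ne_one (Nat.dvd_one.mp hd)
  have hg0 : g ≠ 0 := by
    intro h
    have : cuspCoeff g 1 = 0 := by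
      rw [h]
      change (UpperHalfPlane.qExpansion 1 ⇑(0 : CuspForm (Gamma0 L) 2)).coeff 1 = 0
      rw [CuspForm.coe_zero, UpperHalfPlane.qExpansion_zero]
      simp
    rw [hg1] at this
    exact one_ne_zero this
  haveI : DiscreteTopology (AddSubgroup.toIntSubmodule (periodLattice g)) := by
    refine discreteTopology_periodLattice_of_mul_mem g (L := LW) (c := (c₀ : ℂ) * D)
      (mul_ne_zero (by exact_mod_cast hc₀) hD0) fun z hz ↦ ?_
    rw [mul_assoc]
    exact hc₀Λ _ (hDΛ z hz)
  obtain ⟨Lg, hLg⟩ := exists_periodPair_lattice_eq_periodLattice g hg0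
  have hLg' : ∀ x, x ∈ Lg.lattice ↔ x ∈ periodLattice g := fun x ↦ by
    rw [← hLg]; rfl
  -- `g₂(Λ_g), g₃(Λ_g) ∈ ℚ`: the short model of `ℂ/Λ_g` over `ℚ`
  have hrat : ∀ n, ∃ q : ℚ, (q : ℂ) = cuspCoeff g n := fun n ↦ by
    rw [hg n]
    split_ifs
    · exact ⟨0, by simp⟩
    · obtain ⟨z, hz⟩ := hint n
      exact ⟨z, by rw [hz, Rat.cast_intCast]⟩
  obtain ⟨⟨q₂, hq₂⟩, ⟨q₃, hq₃⟩⟩ := PeriodPair.ratCast_g₂_g₃_of_lattice_eq_periodLattice g hg0 hrat Lg hLg'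
  set a₄ : ℚ := -q₂ / 4 with ha₄
  set a₆ : ℚ := -q₃ / 4 with ha₆
  have h₂ : Lg.g₂ = -4 * (a₄ : ℂ) := by rw [← hq₂, ha₄]; push_cast; ring
  have h₃ : Lg.g₃ = -4 * (a₆ : ℂ) := by rw [← hq₃, ha₆]; push_cast; ring
  set E : WeierstrassCurve ℚ := { a₁ := 0, a₂ := 0, a₃ := 0, a₄ := a₄, a₆ := a₆ } with hE
  haveI hEe : E.IsElliptic := isElliptic_shortModel h₂ h₃
  have hEL : IsNeronLatticeOf (E.baseChange ℂ) Lg := isNeronLatticeOf_shortModel h₂ h₃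
  -- a global minimal model `A = C • E`, with Néron lattice `u Λ_g`
  obtain ⟨C, hC⟩ := WeierstrassCurve.hasGlobalMinimalModel_rat_holds E
  set c : ℚ := (C.u : ℚ) with hcdef
  have hc : c ≠ 0 := C.u.ne_zero
  have hcC : (c : ℂ) ≠ 0 := by exact_mod_cast hc
  have hLA : IsNeronLatticeOf ((C • E).baseChange ℂ) (Lg.mulLeft (c : ℂ) hcC) := by
    have hmap : (C • E).baseChange ℂ = (C.map (algebraMap ℚ ℂ)) • E.baseChange ℂ := by
      simp only [WeierstrassCurve.baseChange, WeierstrassCurve.map_variableChange]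
    have h := hEL.smul (C.map (algebraMap ℚ ℂ))
    rw [hmap]
    convert h using 2
    simp [hcdef, WeierstrassCurve.VariableChange.map_u]
  have hlat : ∀ z : ℂ, z ∈ (Lg.mulLeft (c : ℂ) hcC).lattice ↔ ∃ w ∈ periodLattice g, z = (c : ℂ) * w := fun z ↦ by
    rw [PeriodPair.mem_mulLeft_lattice, hLg']
    constructor
    · intro hz
      exact ⟨_, hz, by rw [← mul_assoc, mul_inv_cancel₀ hcC, one_mul]⟩
    · rintro ⟨w, hw, rfl⟩
      rwa [← mul_assoc, inv_mul_cancel₀ hcC, one_mul]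
  -- `A ~ W`: `(c₀ D / c) Λ_A ⊆ Λ_W`
  have hAW : WeierstrassCurve.IsIsogenous (C • E) W := by
    refine isIsogenous_of_forall_mul_mem_lattice hLA.1 hLA.2 hLW.1 hLW.2 (c := (c₀ : ℚ) * D / c)
      (div_ne_zero (mul_ne_zero (by exact_mod_cast hc₀) (by exact_mod_cast prod_sq_ne_zero_of_prime S hS)) hc)
      fun z hz ↦ ?_
    obtain ⟨w, hw, rfl⟩ := (hlat z).mp hz
    have : (((c₀ : ℚ) * D / c : ℚ) : ℂ) * ((c : ℂ) * w) = (c₀ : ℂ) * ((D : ℂ) * w) := by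
      push_cast
      field_simp
    rw [this]
    exact hc₀Λ _ (hDΛ w hw)
  exact ⟨C • E, inferInstance, hC, Lg.mulLeft (c : ℂ) hcC, c, hLA, hc, hlat, hAW.symm_of_charZero⟩

end Summit.BirchSwinnertonDyer.BirchSwinnertonDyer.Theorems.MazurTateCongruenceAtTwoR.DepletedLattice

end
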